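import Summits.BirchSwinnertonDyer.BirchSwinnertonDyer.Theorems.ErratumRoadFiveNonSurjCornerBranchesDefs
import Summits.BirchSwinnertonDyer.BirchSwinnertonDyer.Theorems.ClassRecordThreeCornerAtThreeBranchesDefs
import Literature.NumberTheory.EllipticCurves.PAdicLFunctionMultiplicativeInterpolation
import HarnessLib

/-!
# Route `ErratumRoadFive` (rung K2) ∕ `ClassRecordThree` (rung K2@3): the ANALYTIC μ = 0 children `NonSurjCornerTwinMuAn`
# (item stmt-BirchSwinnertonDyer-19948, parent 19065) and `CornerAtThreeTwistMuAn` (proposed child of 19111) ON THE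
# UNIT-VALUE LOCUS AT A NON-SPLIT PRIME — the constant term of the Néron-normalised Mazur–Tate–Teitelbaum function is
# `2·L(E^d,1)/Ω(E^d)`, so a `p`-unit special value IS the certificate (cell `bsd-stepL`, seat `bsd-stepL-corner-p1` g7;
# `--supports stmt-BirchSwinnertonDyer-19948`)

WHAT. The analytic child asks, at every non-surjective leaf twin `Wd` (class X11a, `p ∥ N_d`, `p ∈ {5,7}`; resp. the
odd Heegner twins of a (T4″)@3 corner pair at `p = 3`), for SOME `p`-adic unit coefficient of `ϖ·L`, `L` the
Mazur–Tate–Teitelbaum function of the newform `f` of `Wd` with allowable root `a = a_p(Wd) = ±1` and `ϖ·Ω_{Wd} = Ω⁺_f`.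
At a NON-SPLIT multiplicative `p` (`a = −1`) there is no exceptional zero: the interpolation package
`IsMultPAdicLFunctionOf f p (−1) L` (MTT §I.10 with `ε(p) = 0`, Greenberg LNM 1716 §4 «`l_v = 2 = (1 − α_v⁻¹)`»; tree
`IsMultPAdicLFunctionOf.constantCoeff_of_neg_one`) reads `L(0) = 2·[0]⁺_f`, so the `T⁰`-coefficient of `ϖ·L` is
`2·ϖ·[0]⁺_f = 2·L(Wd,1)/Ω(Wd)` — and whenever the Néron-normalised special value `ϖ·[0]⁺_f` is a `p`-adic unit
(`p` odd), THAT coefficient is the certificate (`n = 0`). This is exactly what the cell's per-pair certificates at the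
non-split corner primes compute (HOME/corner/g6/CERT-TWINMUAN-5.tsv: «at a non-split corner prime the certificate is
simply L(E^d,1)/Ω(E^d) is a 5-adic unit (8, 32, 72, 6, 6, 6)»; CERT-TWISTMUAN-3.tsv likewise); by BSD for the rank-0
twin it is the locus `p ∤ #Ш(Wd)·∏c_ℓ(Wd)/#Wd(ℚ)_tors²`.

* §1 `MuAnUnit.coeff_zero_C_mul_of_neg_one` — `[T⁰](ϖ·L) = ϖ·(2·[0]⁺_f)` under `IsMultPAdicLFunctionOf f p (−1) L`.
* §2 `MuAnUnit.exists_norm_coeff_eq_one_of_neg_one` — `p ≠ 2` (so `‖2‖_p = 1`) and `‖ϖ·[0]⁺_f‖_p = 1` ⟹ `∃ n, ‖[Tⁿ](ϖ·L)‖_p = 1`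
  (`n = 0`); and the `padicValRat` form `…_of_padicValRat_eq_zero`.
* §3 **`Theorems.nonSurjCornerTwinMuAn_nonsplit_of_unit_value`** — the registered stub `stub_twinMuAn_nonsplit` of 19948
  (Cruxes/NonSurjCornerTwinMuAn/Lines/birth.lean, 055bfd2479eca4e0) VERBATIM plus ONE hypothesis «`ϖ·[0]⁺_f` is a
  `p`-adic unit» — FACT-FREE; and **`Theorems.cornerAtThreeTwistMuAn_nonsplit_of_unit_value`** — the same for the
  proposed 19111 child's non-split stub (`stub_twistMuAn3_nonsplit`, HOME/corner/g7/bc3/CornerAtThreeTwistMuAn_birth.lean).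

HONEST FRAMING: five theorems (no definition, no named fact, no `sorry`), all elementary consequences of the
interpolation property's constant term; nothing is asserted about any curve; the OPEN content of the analytic children
is the complementary locus (non-split twins with `p ∣ L(Wd,1)/Ω(Wd)` — e.g. 21660u1's twins at 5, whose unit
coefficient is `[T²]` — and ALL split twins, where `L(0) = 0` and `ord_p [T¹] = ord_p 𝓛_p·[0]⁺ ≥ 1`); items 19948 ∕
19111 do NOT close; BSD is not advanced; no census word moves (T7).

References: [MazurTateTeitelbaum1986] §I.10 (ε(p) = 0, allowable root a_p), §I.14; [GreenbergLNM1716] §4 (PDF p. 113,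
`l_v = 2`); [Wuthrich2014] Cor. 18 (p. 398) (`ϖ·L ∈ Λ`); tree `Literature/…/PAdicLFunctionMultiplicativeInterpolation.lean`
(b2b x11a), `Theorems/ErratumRoadFiveNonSurjCornerBranchesDefs.lean` (p486726), `…ClassRecordThreeCornerAtThreeBranchesDefs.lean` (p488767).
-/

set_option autoImplicit false
set_option linter.dupNamespace false

noncomputable section

open scoped Classical NumberField MatrixGroups ModularForm

namespace Summit.BirchSwinnertonDyer.Rank1Residual.X11b.MuAnUnit

open CongruenceSubgroup WeierstrassCurve Literature.NumberTheory.EllipticCurves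
  Literature.NumberTheory.EllipticCurves.ModularForms

variable {N : ℕ} {f : CuspForm (Gamma0 N) 2} {p : ℕ} [Fact p.Prime]

/-! ### §1 The constant term of `ϖ·L` at a non-split prime -/

/-- **`[T⁰](ϖ·L) = ϖ·(2·[0]⁺_f)` at a non-split multiplicative prime** (`a = −1`: no exceptional zero; MTT §I.10,
Greenberg LNM 1716 §4). [cite: GreenbergLNM1716, §4 (PDF p. 113)] [cite: MazurTateTeitelbaum1986, §I.10 and §I.14] -/
theorem coeff_zero_C_mul_of_neg_one {L : PowerSeries ℚ_[p]} (hL : IsMultPAdicLFunctionOf f p (-1) L) (c : ℚ_[p]) :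
    PowerSeries.coeff 0 (PowerSeries.C c * L) = c * (2 * (ratPlusSymbol f 0 : ℚ_[p])) := by
  rw [PowerSeries.coeff_C_mul, PowerSeries.coeff_zero_eq_constantCoeff_apply, hL.constantCoeff_of_neg_one]

/-! ### §2 A unit special value is the certificate -/

/-- **Unit special value ⟹ analytic μ = 0 certificate at `n = 0` (non-split prime, `p` odd).** If
`‖ϖ·[0]⁺_f‖_p = 1` then `[T⁰](ϖ·L) = 2·ϖ·[0]⁺_f` is a `p`-adic unit. Elementary.
[cite: GreenbergLNM1716, §4 (PDF p. 113)] [cite: MazurTateTeitelbaum1986, §I.10] -/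
theorem exists_norm_coeff_eq_one_of_neg_one (hp2 : p ≠ 2) {L : PowerSeries ℚ_[p]}
    (hL : IsMultPAdicLFunctionOf f p (-1) L) (ϖ : ℚ)
    (hunit : ‖((ϖ : ℚ) : ℚ_[p]) * (ratPlusSymbol f 0 : ℚ_[p])‖ = 1) :
    ∃ n : ℕ, ‖PowerSeries.coeff n (PowerSeries.C ((ϖ : ℚ) : ℚ_[p]) * L)‖ = 1 := by
  -- `‖2‖_p = 1` for odd `p` (cf. `…PAdicOrderThesisR2.WieferichJet.norm_two_eq_one`, not imported to keep this file light)
  have h2 : ‖(2 : ℚ_[p])‖ = 1 := by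
    have hle : ‖((2 : ℤ) : ℚ_[p])‖ ≤ 1 := Padic.norm_int_le_one 2
    have hnlt : ¬ ‖((2 : ℤ) : ℚ_[p])‖ < 1 := by
      rw [Padic.norm_intCast_lt_one_iff]
      intro h
      have hp : p ∣ 2 := by exact_mod_cast h
      exact hp2 ((Nat.prime_dvd_prime_iff_eq (Fact.out) Nat.prime_two).mp hp)
    have : ((2 : ℤ) : ℚ_[p]) = (2 : ℚ_[p]) := by norm_num
    rw [this] at hle hnlt
    exact le_antisymm hle (not_lt.mp hnlt)
  refine ⟨0, ?_⟩
  rw [coeff_zero_C_mul_of_neg_one hL, mul_left_comm, norm_mul, h2, one_mul, hunit]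

/-- The same with the hypothesis in valuation currency: `ϖ·[0]⁺_f ≠ 0` and `ord_p(ϖ·[0]⁺_f) = 0`. [folklore] -/
theorem exists_norm_coeff_eq_one_of_neg_one_of_padicValRat_eq_zero (hp2 : p ≠ 2) {L : PowerSeries ℚ_[p]}
    (hL : IsMultPAdicLFunctionOf f p (-1) L) (ϖ : ℚ) (hne : ϖ * ratPlusSymbol f 0 ≠ 0)
    (hval : padicValRat p (ϖ * ratPlusSymbol f 0) = 0) :
    ∃ n : ℕ, ‖PowerSeries.coeff n (PowerSeries.C ((ϖ : ℚ) : ℚ_[p]) * L)‖ = 1 := by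
  refine exists_norm_coeff_eq_one_of_neg_one hp2 hL ϖ ?_
  rw [← Rat.cast_mul, Padic.eq_padicNorm, padicNorm.eq_zpow_of_nonzero hne, hval, neg_zero, zpow_zero,
    Rat.cast_one]

end Summit.BirchSwinnertonDyer.Rank1Residual.X11b.MuAnUnit

namespace Summit.BirchSwinnertonDyer.BirchSwinnertonDyer.Theorems

open CongruenceSubgroup WeierstrassCurve Literature.NumberTheory.EllipticCurves
  Literature.NumberTheory.EllipticCurves.ModularForms Literature.NumberTheory.EllipticCurves.Rank1Residual
  Summit.BirchSwinnertonDyer.Rank1Residual Summit.BirchSwinnertonDyer.Rank1Residual.X11b.MuAnUnit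

/-! ### §3 The analytic children's non-split stubs on the unit-value locus -/

/-- **`stub_twinMuAn_nonsplit` of 19948 `NonSurjCornerTwinMuAn` ON THE UNIT-VALUE LOCUS** — the registered stub text
verbatim (non-surjective X11a leaf twin `Wd`, `p ∈ {5,7}`, `p ∣ ord_p Δ_min`, NON-split at `p`, newform `f`, period
ratio `ϖ`, MTT function `L` with `a = −1`) plus ONE hypothesis «`‖ϖ·[0]⁺_f‖_p = 1`» (the Néron-normalised special value
`L(Wd,1)/Ω(Wd)` is a `p`-adic unit): then `[T⁰](ϖ·L)` is the unit coefficient. FACT-FREE; most frame binders are unused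
and displayed only so that the statement is the stub's text plus one clause. Nothing booked.
[cite: GreenbergLNM1716, §4 (PDF p. 113) and §1 Conj. 1.11 (shape)] [cite: MazurTateTeitelbaum1986, §I.10] -/
theorem nonSurjCornerTwinMuAn_nonsplit_of_unit_value :
    ∀ (Wd : WeierstrassCurve ℚ) [Wd.IsElliptic] [Wd.IsGloballyMinimal] (p : ℕ) [Fact p.Prime],
      ClassX11a Wd p → ¬ Surj Wd p → (p = 5 ∨ p = 7) → p ∣ padicValInt p Wd.minimalDiscriminantInt →
      ¬ Wd.HasSplitMultiplicativeReductionAtPrime p →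
      ∀ {N : ℕ} [NeZero N] (f : CuspForm (Gamma0 N) 2), IsNewformOf Wd f →
      ∀ (ϖ : ℚ), (ϖ : ℝ) * Wd.realPeriodRat = plusPeriod f →
      ∀ (L : PowerSeries ℚ_[p]), IsMultPAdicLFunctionOf f p (-1) L →
        ‖((ϖ : ℚ) : ℚ_[p]) * (ratPlusSymbol f 0 : ℚ_[p])‖ = 1 →
        ∃ n : ℕ, ‖PowerSeries.coeff n (PowerSeries.C ((ϖ : ℚ) : ℚ_[p]) * L)‖ = 1 := by
  intro Wd _ _ p _ hXa _ _ _ _ N _ f _ ϖ _ L hL hunit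
  exact exists_norm_coeff_eq_one_of_neg_one hXa.2.1 hL ϖ hunit

/-- **`stub_twistMuAn3_nonsplit` of the proposed 19111 child `CornerAtThreeTwistMuAn` ON THE UNIT-VALUE LOCUS** — the
kit's stub text verbatim (odd Heegner twin `Wd = Cd • E^{(d_K)}` of a (T4″)@3 corner pair, NON-split at `3`) plus ONE
hypothesis «`‖ϖ·[0]⁺_f‖₃ = 1`». FACT-FREE. Nothing booked. [cite: GreenbergLNM1716, §4 (PDF p. 113)]
[cite: MazurTateTeitelbaum1986, §I.10] -/
theorem cornerAtThreeTwistMuAn_nonsplit_of_unit_value :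
    ∀ (W : WeierstrassCurve ℚ) [W.IsElliptic] [W.IsGloballyMinimal] (K : Type) [Field K] [NumberField K]
      (Wd : WeierstrassCurve ℚ) [Wd.IsElliptic] [Wd.IsGloballyMinimal] (Cd : VariableChange ℚ),
      ClassX11b W 3 → ¬ Surj W 3 → IsImaginaryQuadratic K → Odd (NumberField.discr K) →
      SatisfiesHeegnerHypothesis (W.conductorNorm ℤ) K →
      (W.quadraticTwist (NumberField.discr K : ℚ)).entireLFunction 1 ≠ 0 →
      Cd • W.quadraticTwist (NumberField.discr K : ℚ) = Wd →
      ¬ Wd.HasSplitMultiplicativeReductionAtPrime 3 →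
      ∀ {N : ℕ} [NeZero N] (f : CuspForm (Gamma0 N) 2), IsNewformOf Wd f →
      ∀ (ϖ : ℚ), (ϖ : ℝ) * Wd.realPeriodRat = plusPeriod f →
      ∀ (L : PowerSeries ℚ_[3]), IsMultPAdicLFunctionOf f 3 (-1) L →
        ‖((ϖ : ℚ) : ℚ_[3]) * (ratPlusSymbol f 0 : ℚ_[3])‖ = 1 →
        ∃ n : ℕ, ‖PowerSeries.coeff n (PowerSeries.C ((ϖ : ℚ) : ℚ_[3]) * L)‖ = 1 := by
  intro W _ _ K _ _ Wd _ _ Cd _ _ _ _ _ _ _ _ N _ f _ ϖ _ L hL hunit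
  haveI : Fact (Nat.Prime 3) := ⟨Nat.prime_three⟩
  exact exists_norm_coeff_eq_one_of_neg_one (p := 3) (by decide) hL ϖ hunit

end Summit.BirchSwinnertonDyer.BirchSwinnertonDyer.Theorems

end
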